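import Mathlib
import Summits.Ventures.HodgeRepro0.P1LatticeIndexTwoExactHodge
import Summits.Ventures.HodgeRepro0.P1LatticeIndexOneA
import Summits.Ventures.HodgeRepro0.P1LatticeIndexOneB
import Summits.Ventures.HodgeRepro0.P1LatticeIndexOneC

/-!
# P1LatticeIndexOneBridge1 — D13's THEOREM A (proofs/P1-FermatLatticeClosure-v1.2.md l.4, DECLARED STATUS l.4789) at its
INDEX-1 degrees: H_M = L_M AS AN EQUALITY — THE PULL-BACK LEMMA AND THE BRIDGES FOR THE NAMESPACES A, B, C of p1 (g27)'s
artefact (pub-hodge-repro0, p1 (g29), 2026-08-30), on the general lemmas of lean/P1LatticeIndexTwoExactHodge.lean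
(the weight identity `conMat_mulVec_oddVec`, `units_ok_of_lists`), Core3's `mem_span_of_mulVec`.

Supporting artefact in the sense of ROUTE.md R-5 (finite combinatorics / exact arithmetic only; never the discharge of a
Hodge-theoretic step; record-only).  THE OBJECTS, as p1 (g27)'s artefact lean/P1LatticeIndexOneA–I.lean states them (nine
self-contained files, each with its own copies of the definitions in its own namespace): a `Block` = (a level m′ ∣ M, a unit
translate t, a kind, a base multiset of level m′, the σ parameters p, i); `Block.ms M` = the base translated by t and pulled
back by M/m′ — the multiset {(M/m′)·((t·x) mod m′) mod M}; `Block.ok M` = the page's legitimacy (Lemma 1 (b) of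
proofs/P1-FermatLatticeClosure-v1.2.md: m′ ∣ M, 3 ≤ m′, t a unit mod M, the base a Hodge multiset of level m′ with entries
below m′, and a Hodge 4-multiset / a split Hodge 6-multiset / Aoki's σ_{p,i} by the kind); `oddVec` on lists; `conMat`;
per degree `units_complete_M`, `blocks_ok_M` (the listed blocks are legitimate) and `generated_M` — every s with B_M·s = 0
is an integer combination of the listed blocks' odd vectors (or s = 0 at the 25 degrees where H_M = 0): H_M ⊆ L_M.
THIS ARTEFACT adds the other containment, in general, and states the equality: H_M := ker (mulVecLin B_M) and
L_M := the ℤ-span of the odd vectors of ALL legitimate blocks (`X_L M n`, the page's BLK(M) as a PREDICATE on `Block`,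
not the listed set) satisfy H_M = L_M at every one of the 88 index-1 degrees — THEOREM A's «[H_M : L_M] = 1» on the
coordinates a < M/2 as an EQUALITY OF LATTICES (the coordinate M/2 of an even M taken modulo 2e_{M/2}, the page's l.7
bookkeeping, as in every p1 artefact).

THE PULL-BACK LEMMA (`isHodge_pullback`, for every M): a unit translate (by t, a unit of ℤ/M) of a Hodge multiset of
level m′ ∣ M, pulled back by k = M/m′, is a Hodge multiset of level M — its entries are k·r with 0 < r < m′, and its
weight at a unit u of ℤ/M is k times the weight of the base at the unit (u·t) mod m′ of ℤ/m′, since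
(k·(u·r)) mod (k·m′) = k·((u·r) mod m′) (`Nat.mul_mod_mul_left`); `coprime_mul_mod`: (u·t) mod m′ is prime to m′.
THE BRIDGE, per namespace X (one text, the letter substituted): `X_isHodge_to` — their Bool `isHodge` implies the g28
predicate `IsHodge` (entries below the level); `X_ok_isHodge` — a legitimate block's multiset at M is a Hodge multiset of
level M (the pull-back lemma); `X_L M n` — L_M as a submodule; `X_mem_ker_of_ok` — every legitimate block's odd vector
(their `oddVec` on the list = the g28 `oddVec` on the coerced multiset, `Multiset.coe_count`) satisfies every weight
constraint (their `conMat` IS the g28 `conMat`, definitionally); `X_span_le_ker` — L_M ≤ H_M; `X_ker_le_span` /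
`X_ker_le_span_of_zero` — H_M ≤ L_M from `generated_M` (every row of `genMat M blocks g n` is the odd vector of a listed,
hence legitimate, block; or s = 0).  The per-degree equalities are in lean/P1LatticeIndexOneEqA.lean (the 48 degrees of the
files A–C) and lean/P1LatticeIndexOneEqB.lean (the 40 degrees of D–I).
NOT formalised: claim(·) for the blocks (Shioda 1981 Thm 4.3 / Lefschetz (1,1), Aoki 1987 Thm 2-1 / Thm 1-4); anything
Hodge-theoretic.
Nothing here asserts anything about whether the statement of README §1 has been proved elsewhere.
-/

namespace HodgeRepro0.P1.P1LatticeIndexTwoExact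
open Matrix
/-- the residue (u·t) mod m′ of a product of two numbers prime to m′ is prime to m′ -/
theorem coprime_mul_mod (u t m' : ℕ) (hu : Nat.Coprime u m') (ht : Nat.Coprime t m') :
    Nat.Coprime ((u * t) % m') m' := by
  have h1 : Nat.Coprime (u * t) m' := Nat.Coprime.mul_left hu ht
  unfold Nat.Coprime at h1 ⊢
  rw [← Nat.gcd_rec, Nat.gcd_comm]
  exact h1

/-- THE PULL-BACK LEMMA: a unit translate (by t, a unit of ℤ/M) of a Hodge multiset `base` of level m′ ∣ M (its entries
lie in [1, m′−1]), pulled back by k = M/m′ — the multiset {k·((t·x) mod m′) mod M : x ∈ base} — is a Hodge multiset of level M: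
the entries are k·r with 0 < r = (t·x) mod m′ < m′, and the weight at a unit u of ℤ/M is k times the weight of `base` at
the unit (u·t) mod m′ of ℤ/m′, since (k·(u·r)) mod (k·m′) = k·((u·r) mod m′) -/
theorem isHodge_pullback (M m' t : ℕ) (base : List ℕ) (hM : 0 < M) (hm : M % m' = 0) (hm0 : 0 < m')
    (ht : Nat.gcd t M = 1) (hH : IsHodge m' (base : Multiset ℕ)) :
    IsHodge M ((base.map (fun x => (M / m') * ((t * x) % m') % M) : List ℕ) : Multiset ℕ) := by
  obtain ⟨k, hk⟩ : ∃ k, M = k * m' := ⟨M / m', (Nat.div_mul_cancel (Nat.dvd_of_mod_eq_zero hm)).symm⟩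
  have hkM : M / m' = k := by rw [hk, Nat.mul_div_cancel k hm0]
  have hk0 : 0 < k := by
    rcases Nat.eq_zero_or_pos k with h | h
    · rw [h, Nat.zero_mul] at hk
      omega
    · exact h
  have hdvd : m' ∣ M := Dvd.intro_left k hk.symm
  have htm : Nat.Coprime t m' := Nat.Coprime.coprime_dvd_right hdvd ht
  obtain ⟨hev, hent, hwt⟩ := hH
  have hval : ∀ x ∈ base, (M / m') * ((t * x) % m') % M = k * ((t * x) % m') := by
    intro x _
    rw [hkM]
    apply Nat.mod_eq_of_lt
    rw [hk]
    exact Nat.mul_lt_mul_of_pos_left (Nat.mod_lt _ hm0) hk0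
  refine ⟨?_, ?_, ?_⟩
  · simpa [Multiset.coe_card, List.length_map] using hev
  · intro a ha
    rw [Multiset.mem_coe, List.mem_map] at ha
    obtain ⟨x, hx, rfl⟩ := ha
    have hx' := hent x (Multiset.mem_coe.mpr hx)
    rw [hval x hx]
    refine ⟨Nat.mul_pos hk0 (mul_mod_pos m' t x htm hx'), ?_⟩
    rw [hk]
    exact Nat.mul_lt_mul_of_pos_left (Nat.mod_lt _ hm0) hk0
  · intro u hu hg
    rw [wt_coe, Multiset.coe_card, List.length_map]
    have hum : Nat.Coprime u m' := Nat.Coprime.coprime_dvd_right hdvd hg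
    have hv : Nat.Coprime ((u * t) % m') m' := coprime_mul_mod u t m' hum htm
    have hw := hwt ((u * t) % m') (Nat.mod_lt _ hm0) hv
    rw [wt_coe, Multiset.coe_card] at hw
    -- the weight at u is k times the weight of base at (u·t) mod m'
    have hpt : ∀ x ∈ base, (u * ((M / m') * ((t * x) % m') % M)) % M = k * ((((u * t) % m') * x) % m') := by
      intro x hx
      rw [hval x hx, show u * (k * ((t * x) % m')) = k * (u * ((t * x) % m')) by ring, hk, Nat.mul_mod_mul_left]
      congr 1
      have e1 : (u * ((t * x) % m')) % m' = (u * (t * x)) % m' := by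
        rw [Nat.mul_mod u ((t * x) % m') m', Nat.mod_mod, ← Nat.mul_mod]
      have e2 : (((u * t) % m') * x) % m' = ((u * t) * x) % m' := by
        rw [Nat.mul_mod ((u * t) % m') x m', Nat.mod_mod, ← Nat.mul_mod]
      rw [e1, e2, Nat.mul_assoc]
    have hS : S M u (base.map (fun x => (M / m') * ((t * x) % m') % M)) = k * S m' ((u * t) % m') base := by
      simp only [S, List.map_map, Function.comp_def]
      rw [List.map_congr_left hpt, List.sum_map_mul_left]
    rw [hS, hk]
    calc 2 * (k * S m' ((u * t) % m') base) = k * (2 * S m' ((u * t) % m') base) := by ring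
      _ = k * (base.length * m') := by rw [hw]
      _ = base.length * (k * m') := by ring


/-! ## The bridge for the namespace `P1LatticeIndexOneA` (the degree file A) -/

/-- (A) their Bool Hodge test implies the multiset predicate `IsHodge` (with the entries below the level) -/
theorem A_isHodge_to (mm : ℕ) (x : List ℕ) (h : P1LatticeIndexOneA.isHodge mm x = true) (hlt : ∀ a ∈ x, a < mm) :
    IsHodge mm (x : Multiset ℕ) := by
  simp only [P1LatticeIndexOneA.isHodge, Bool.and_eq_true, beq_iff_eq, List.all_eq_true, bne_iff_ne, ne_eq,
    List.mem_filter, List.mem_range, decide_eq_true_eq] at h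
  obtain ⟨⟨h1, h2⟩, h3⟩ := h
  refine ⟨by rw [Multiset.coe_card, Nat.even_iff]; exact h1, ?_, fun u hu hg => by rw [wt_coe]; exact h3 u ⟨hu, hg⟩⟩
  intro a ha
  rw [Multiset.mem_coe] at ha
  have ha1 := h2 a ha
  refine ⟨?_, hlt a ha⟩
  rcases Nat.eq_zero_or_pos a with h0 | h0
  · exact absurd (by rw [h0, Nat.zero_mod]) ha1
  · exact h0

/-- (A) a legitimate block's multiset at M is a Hodge multiset of level M (the pull-back lemma) -/
theorem A_ok_isHodge (M : ℕ) (hM : 0 < M) (b : P1LatticeIndexOneA.Block) (h : b.ok M = true) :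
    IsHodge M ((b.ms M : List ℕ) : Multiset ℕ) := by
  unfold P1LatticeIndexOneA.Block.ok at h
  simp only [Bool.and_eq_true, beq_iff_eq, decide_eq_true_eq, List.all_eq_true] at h
  obtain ⟨⟨⟨⟨⟨hdiv, h3⟩, ht⟩, hlt⟩, hH⟩, _⟩ := h
  unfold P1LatticeIndexOneA.Block.ms
  exact isHodge_pullback M b.level b.t b.base hM hdiv (by omega) ht (A_isHodge_to b.level b.base hH hlt)

/-- (A) L_M as a submodule: the ℤ-span of the odd vectors of ALL legitimate blocks of the degree M (the page's BLK(M) as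
a PREDICATE — every `Block` passing `Block.ok M`, not the listed ones) on the coordinates a < M/2 -/
abbrev A_L (M n : ℕ) : Submodule ℤ (Fin n → ℤ) :=
  Submodule.span ℤ ((fun ms : List ℕ => (fun a : Fin n => P1LatticeIndexOneA.oddVec M ms a)) ''
    {ms | ∃ b : P1LatticeIndexOneA.Block, b.ok M = true ∧ ms = b.ms M})

/-- (A) every legitimate block's odd vector satisfies every weight constraint -/
theorem A_mem_ker_of_ok {n u : ℕ} (M : ℕ) (hM : 0 < M) (hn : n = (M - 1) / 2) (unitsF : Fin u → ℕ)
    (hU : ∀ i, unitsF i < M ∧ Nat.gcd (unitsF i) M = 1) (b : P1LatticeIndexOneA.Block) (h : b.ok M = true) :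
    P1LatticeIndexOneA.conMat (n := n) M unitsF *ᵥ (fun a => P1LatticeIndexOneA.oddVec M (b.ms M) a) = 0 := by
  have e : (fun a : Fin n => P1LatticeIndexOneA.oddVec M (b.ms M) a) =
      oddVec (n := n) M ((b.ms M : List ℕ) : Multiset ℕ) := by
    funext a
    simp [P1LatticeIndexOneA.oddVec, oddVec, Multiset.coe_count]
  rw [e]
  exact conMat_mulVec_oddVec M hn unitsF hU _ (A_ok_isHodge M hM b h)

/-- (A) L_M ≤ H_M -/
theorem A_span_le_ker {n u : ℕ} (M : ℕ) (hM : 0 < M) (hn : n = (M - 1) / 2) (unitsF : Fin u → ℕ)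
    (hU : ∀ i, unitsF i < M ∧ Nat.gcd (unitsF i) M = 1) :
    A_L M n ≤ LinearMap.ker (Matrix.mulVecLin (P1LatticeIndexOneA.conMat (n := n) M unitsF)) := by
  rw [Submodule.span_le]
  rintro _ ⟨ms, ⟨b, hb, rfl⟩, rfl⟩
  rw [SetLike.mem_coe, LinearMap.mem_ker, Matrix.mulVecLin_apply]
  exact A_mem_ker_of_ok M hM hn unitsF hU b hb

/-- (A) H_M ≤ L_M from the g27 certificate: every s ∈ H_M is an integer combination of the listed blocks' odd vectors, and
every listed block is legitimate -/
theorem A_ker_le_span {n u g : ℕ} (M : ℕ) (B : Matrix (Fin u) (Fin n) ℤ) (blocks : List P1LatticeIndexOneA.Block)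
    (hlen : blocks.length = g) (hok : blocks.all (P1LatticeIndexOneA.Block.ok M) = true)
    (hgen : ∀ s : Fin n → ℤ, B *ᵥ s = 0 → ∃ c : Fin g → ℤ, s = (P1LatticeIndexOneA.genMat M blocks g n).transpose *ᵥ c) :
    LinearMap.ker (Matrix.mulVecLin B) ≤ A_L M n := by
  intro s hs
  rw [LinearMap.mem_ker, Matrix.mulVecLin_apply] at hs
  obtain ⟨c, hc⟩ := hgen s hs
  rw [hc]
  refine mem_span_of_mulVec _ _ (fun j => ?_) c
  have hj : j.val < blocks.length := by
    rw [hlen]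
    exact j.isLt
  have hmem : blocks.getD j.val ⟨3, 1, 0, [], 0, 0⟩ ∈ blocks := by
    rw [List.getD_eq_getElem _ _ hj]
    exact List.getElem_mem hj
  exact ⟨(blocks.getD j.val ⟨3, 1, 0, [], 0, 0⟩).ms M, ⟨_, (List.all_eq_true.mp hok) _ hmem, rfl⟩, rfl⟩

/-- (A) H_M ≤ L_M at a degree where H_M = 0 -/
theorem A_ker_le_span_of_zero {n u : ℕ} (M : ℕ) (B : Matrix (Fin u) (Fin n) ℤ)
    (hgen : ∀ s : Fin n → ℤ, B *ᵥ s = 0 → s = 0) : LinearMap.ker (Matrix.mulVecLin B) ≤ A_L M n := by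
  intro s hs
  rw [LinearMap.mem_ker, Matrix.mulVecLin_apply] at hs
  rw [hgen s hs]
  exact Submodule.zero_mem _

/-! ## The bridge for the namespace `P1LatticeIndexOneB` (the degree file B) -/

/-- (B) their Bool Hodge test implies the multiset predicate `IsHodge` (with the entries below the level) -/
theorem B_isHodge_to (mm : ℕ) (x : List ℕ) (h : P1LatticeIndexOneB.isHodge mm x = true) (hlt : ∀ a ∈ x, a < mm) :
    IsHodge mm (x : Multiset ℕ) := by
  simp only [P1LatticeIndexOneB.isHodge, Bool.and_eq_true, beq_iff_eq, List.all_eq_true, bne_iff_ne, ne_eq,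
    List.mem_filter, List.mem_range, decide_eq_true_eq] at h
  obtain ⟨⟨h1, h2⟩, h3⟩ := h
  refine ⟨by rw [Multiset.coe_card, Nat.even_iff]; exact h1, ?_, fun u hu hg => by rw [wt_coe]; exact h3 u ⟨hu, hg⟩⟩
  intro a ha
  rw [Multiset.mem_coe] at ha
  have ha1 := h2 a ha
  refine ⟨?_, hlt a ha⟩
  rcases Nat.eq_zero_or_pos a with h0 | h0
  · exact absurd (by rw [h0, Nat.zero_mod]) ha1
  · exact h0

/-- (B) a legitimate block's multiset at M is a Hodge multiset of level M (the pull-back lemma) -/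
theorem B_ok_isHodge (M : ℕ) (hM : 0 < M) (b : P1LatticeIndexOneB.Block) (h : b.ok M = true) :
    IsHodge M ((b.ms M : List ℕ) : Multiset ℕ) := by
  unfold P1LatticeIndexOneB.Block.ok at h
  simp only [Bool.and_eq_true, beq_iff_eq, decide_eq_true_eq, List.all_eq_true] at h
  obtain ⟨⟨⟨⟨⟨hdiv, h3⟩, ht⟩, hlt⟩, hH⟩, _⟩ := h
  unfold P1LatticeIndexOneB.Block.ms
  exact isHodge_pullback M b.level b.t b.base hM hdiv (by omega) ht (B_isHodge_to b.level b.base hH hlt)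

/-- (B) L_M as a submodule: the ℤ-span of the odd vectors of ALL legitimate blocks of the degree M (the page's BLK(M) as
a PREDICATE — every `Block` passing `Block.ok M`, not the listed ones) on the coordinates a < M/2 -/
abbrev B_L (M n : ℕ) : Submodule ℤ (Fin n → ℤ) :=
  Submodule.span ℤ ((fun ms : List ℕ => (fun a : Fin n => P1LatticeIndexOneB.oddVec M ms a)) ''
    {ms | ∃ b : P1LatticeIndexOneB.Block, b.ok M = true ∧ ms = b.ms M})

/-- (B) every legitimate block's odd vector satisfies every weight constraint -/
theorem B_mem_ker_of_ok {n u : ℕ} (M : ℕ) (hM : 0 < M) (hn : n = (M - 1) / 2) (unitsF : Fin u → ℕ)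
    (hU : ∀ i, unitsF i < M ∧ Nat.gcd (unitsF i) M = 1) (b : P1LatticeIndexOneB.Block) (h : b.ok M = true) :
    P1LatticeIndexOneB.conMat (n := n) M unitsF *ᵥ (fun a => P1LatticeIndexOneB.oddVec M (b.ms M) a) = 0 := by
  have e : (fun a : Fin n => P1LatticeIndexOneB.oddVec M (b.ms M) a) =
      oddVec (n := n) M ((b.ms M : List ℕ) : Multiset ℕ) := by
    funext a
    simp [P1LatticeIndexOneB.oddVec, oddVec, Multiset.coe_count]
  rw [e]
  exact conMat_mulVec_oddVec M hn unitsF hU _ (B_ok_isHodge M hM b h)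

/-- (B) L_M ≤ H_M -/
theorem B_span_le_ker {n u : ℕ} (M : ℕ) (hM : 0 < M) (hn : n = (M - 1) / 2) (unitsF : Fin u → ℕ)
    (hU : ∀ i, unitsF i < M ∧ Nat.gcd (unitsF i) M = 1) :
    B_L M n ≤ LinearMap.ker (Matrix.mulVecLin (P1LatticeIndexOneB.conMat (n := n) M unitsF)) := by
  rw [Submodule.span_le]
  rintro _ ⟨ms, ⟨b, hb, rfl⟩, rfl⟩
  rw [SetLike.mem_coe, LinearMap.mem_ker, Matrix.mulVecLin_apply]
  exact B_mem_ker_of_ok M hM hn unitsF hU b hb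

/-- (B) H_M ≤ L_M from the g27 certificate: every s ∈ H_M is an integer combination of the listed blocks' odd vectors, and
every listed block is legitimate -/
theorem B_ker_le_span {n u g : ℕ} (M : ℕ) (B : Matrix (Fin u) (Fin n) ℤ) (blocks : List P1LatticeIndexOneB.Block)
    (hlen : blocks.length = g) (hok : blocks.all (P1LatticeIndexOneB.Block.ok M) = true)
    (hgen : ∀ s : Fin n → ℤ, B *ᵥ s = 0 → ∃ c : Fin g → ℤ, s = (P1LatticeIndexOneB.genMat M blocks g n).transpose *ᵥ c) :
    LinearMap.ker (Matrix.mulVecLin B) ≤ B_L M n := by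
  intro s hs
  rw [LinearMap.mem_ker, Matrix.mulVecLin_apply] at hs
  obtain ⟨c, hc⟩ := hgen s hs
  rw [hc]
  refine mem_span_of_mulVec _ _ (fun j => ?_) c
  have hj : j.val < blocks.length := by
    rw [hlen]
    exact j.isLt
  have hmem : blocks.getD j.val ⟨3, 1, 0, [], 0, 0⟩ ∈ blocks := by
    rw [List.getD_eq_getElem _ _ hj]
    exact List.getElem_mem hj
  exact ⟨(blocks.getD j.val ⟨3, 1, 0, [], 0, 0⟩).ms M, ⟨_, (List.all_eq_true.mp hok) _ hmem, rfl⟩, rfl⟩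

/-- (B) H_M ≤ L_M at a degree where H_M = 0 -/
theorem B_ker_le_span_of_zero {n u : ℕ} (M : ℕ) (B : Matrix (Fin u) (Fin n) ℤ)
    (hgen : ∀ s : Fin n → ℤ, B *ᵥ s = 0 → s = 0) : LinearMap.ker (Matrix.mulVecLin B) ≤ B_L M n := by
  intro s hs
  rw [LinearMap.mem_ker, Matrix.mulVecLin_apply] at hs
  rw [hgen s hs]
  exact Submodule.zero_mem _

/-! ## The bridge for the namespace `P1LatticeIndexOneC` (the degree file C) -/

/-- (C) their Bool Hodge test implies the multiset predicate `IsHodge` (with the entries below the level) -/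
theorem C_isHodge_to (mm : ℕ) (x : List ℕ) (h : P1LatticeIndexOneC.isHodge mm x = true) (hlt : ∀ a ∈ x, a < mm) :
    IsHodge mm (x : Multiset ℕ) := by
  simp only [P1LatticeIndexOneC.isHodge, Bool.and_eq_true, beq_iff_eq, List.all_eq_true, bne_iff_ne, ne_eq,
    List.mem_filter, List.mem_range, decide_eq_true_eq] at h
  obtain ⟨⟨h1, h2⟩, h3⟩ := h
  refine ⟨by rw [Multiset.coe_card, Nat.even_iff]; exact h1, ?_, fun u hu hg => by rw [wt_coe]; exact h3 u ⟨hu, hg⟩⟩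
  intro a ha
  rw [Multiset.mem_coe] at ha
  have ha1 := h2 a ha
  refine ⟨?_, hlt a ha⟩
  rcases Nat.eq_zero_or_pos a with h0 | h0
  · exact absurd (by rw [h0, Nat.zero_mod]) ha1
  · exact h0

/-- (C) a legitimate block's multiset at M is a Hodge multiset of level M (the pull-back lemma) -/
theorem C_ok_isHodge (M : ℕ) (hM : 0 < M) (b : P1LatticeIndexOneC.Block) (h : b.ok M = true) :
    IsHodge M ((b.ms M : List ℕ) : Multiset ℕ) := by
  unfold P1LatticeIndexOneC.Block.ok at h
  simp only [Bool.and_eq_true, beq_iff_eq, decide_eq_true_eq, List.all_eq_true] at h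
  obtain ⟨⟨⟨⟨⟨hdiv, h3⟩, ht⟩, hlt⟩, hH⟩, _⟩ := h
  unfold P1LatticeIndexOneC.Block.ms
  exact isHodge_pullback M b.level b.t b.base hM hdiv (by omega) ht (C_isHodge_to b.level b.base hH hlt)

/-- (C) L_M as a submodule: the ℤ-span of the odd vectors of ALL legitimate blocks of the degree M (the page's BLK(M) as
a PREDICATE — every `Block` passing `Block.ok M`, not the listed ones) on the coordinates a < M/2 -/
abbrev C_L (M n : ℕ) : Submodule ℤ (Fin n → ℤ) :=
  Submodule.span ℤ ((fun ms : List ℕ => (fun a : Fin n => P1LatticeIndexOneC.oddVec M ms a)) ''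
    {ms | ∃ b : P1LatticeIndexOneC.Block, b.ok M = true ∧ ms = b.ms M})

/-- (C) every legitimate block's odd vector satisfies every weight constraint -/
theorem C_mem_ker_of_ok {n u : ℕ} (M : ℕ) (hM : 0 < M) (hn : n = (M - 1) / 2) (unitsF : Fin u → ℕ)
    (hU : ∀ i, unitsF i < M ∧ Nat.gcd (unitsF i) M = 1) (b : P1LatticeIndexOneC.Block) (h : b.ok M = true) :
    P1LatticeIndexOneC.conMat (n := n) M unitsF *ᵥ (fun a => P1LatticeIndexOneC.oddVec M (b.ms M) a) = 0 := by
  have e : (fun a : Fin n => P1LatticeIndexOneC.oddVec M (b.ms M) a) =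
      oddVec (n := n) M ((b.ms M : List ℕ) : Multiset ℕ) := by
    funext a
    simp [P1LatticeIndexOneC.oddVec, oddVec, Multiset.coe_count]
  rw [e]
  exact conMat_mulVec_oddVec M hn unitsF hU _ (C_ok_isHodge M hM b h)

/-- (C) L_M ≤ H_M -/
theorem C_span_le_ker {n u : ℕ} (M : ℕ) (hM : 0 < M) (hn : n = (M - 1) / 2) (unitsF : Fin u → ℕ)
    (hU : ∀ i, unitsF i < M ∧ Nat.gcd (unitsF i) M = 1) :
    C_L M n ≤ LinearMap.ker (Matrix.mulVecLin (P1LatticeIndexOneC.conMat (n := n) M unitsF)) := by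
  rw [Submodule.span_le]
  rintro _ ⟨ms, ⟨b, hb, rfl⟩, rfl⟩
  rw [SetLike.mem_coe, LinearMap.mem_ker, Matrix.mulVecLin_apply]
  exact C_mem_ker_of_ok M hM hn unitsF hU b hb

/-- (C) H_M ≤ L_M from the g27 certificate: every s ∈ H_M is an integer combination of the listed blocks' odd vectors, and
every listed block is legitimate -/
theorem C_ker_le_span {n u g : ℕ} (M : ℕ) (B : Matrix (Fin u) (Fin n) ℤ) (blocks : List P1LatticeIndexOneC.Block)
    (hlen : blocks.length = g) (hok : blocks.all (P1LatticeIndexOneC.Block.ok M) = true)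
    (hgen : ∀ s : Fin n → ℤ, B *ᵥ s = 0 → ∃ c : Fin g → ℤ, s = (P1LatticeIndexOneC.genMat M blocks g n).transpose *ᵥ c) :
    LinearMap.ker (Matrix.mulVecLin B) ≤ C_L M n := by
  intro s hs
  rw [LinearMap.mem_ker, Matrix.mulVecLin_apply] at hs
  obtain ⟨c, hc⟩ := hgen s hs
  rw [hc]
  refine mem_span_of_mulVec _ _ (fun j => ?_) c
  have hj : j.val < blocks.length := by
    rw [hlen]
    exact j.isLt
  have hmem : blocks.getD j.val ⟨3, 1, 0, [], 0, 0⟩ ∈ blocks := by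
    rw [List.getD_eq_getElem _ _ hj]
    exact List.getElem_mem hj
  exact ⟨(blocks.getD j.val ⟨3, 1, 0, [], 0, 0⟩).ms M, ⟨_, (List.all_eq_true.mp hok) _ hmem, rfl⟩, rfl⟩

/-- (C) H_M ≤ L_M at a degree where H_M = 0 -/
theorem C_ker_le_span_of_zero {n u : ℕ} (M : ℕ) (B : Matrix (Fin u) (Fin n) ℤ)
    (hgen : ∀ s : Fin n → ℤ, B *ᵥ s = 0 → s = 0) : LinearMap.ker (Matrix.mulVecLin B) ≤ C_L M n := by
  intro s hs
  rw [LinearMap.mem_ker, Matrix.mulVecLin_apply] at hs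
  rw [hgen s hs]
  exact Submodule.zero_mem _

end HodgeRepro0.P1.P1LatticeIndexTwoExact
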